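import Summits.QuantumFields.YangMills.Theorems.BalabanUVNodesN07AveragingSubmersionSmallField
import Summits.QuantumFields.YangMills.Theorems.BalabanUVNodesN07AveragingPhaseEquivariance
import Summits.QuantumFields.YangMills.Theorems.BalabanUVNodesN07QOfRecordFlatOnto
import Summits.QuantumFields.YangMills.Theorems.BalabanUVNodesN07CritTangentInClass
import Literature.MathematicalPhysics.QuantumFieldTheory.Balaban1983to89.Node00.BackgroundSelOfRecord
import Summits.QuantumFields.YangMills.Theorems.BalabanUVNodesRootedGaugeCentred

/-!
# BalabanUVNodes ∕ N07 — def-Y's DISPLAYED LETTER `hQ : Function.Surjective (Node00.QOfRecord F N k U₀)` DISCHARGED AT EVERY GUARDED SMALL-FIELD BACKGROUND `U₀`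
# (print's `Q_k(U₀)` of [Balaban1985BackgroundPropagators] (3.13)–(3.16) ∕ [Balaban1985Variational] (44) is ONTO for `U₀` in the small-field class, `k ≤ m + K`):
# the assembly of part (A) (`𝔰𝔲(N)` directions, exact corrector) and part (B) (U(1) line, phase equivariance) through dag-n07-w3's plumbing `QOfRecord_surjective_of_skew`

Track A of `YM-PLAN.md` (cell `pub-ymgap`, HUMAN RULING D-0062), DAG node **N07** = [Balaban1985Variational].  Seat `pub-ymgap-dag-n07-e` (g38), CLAIM-2 part (C); node00-def-Y g36's
E1 word (I.23150) «`hQ` … general small `U₀` by [Balaban1985Averaging] Sect. E — a prover target (N07 side)» and custodian remark I.23221 («TARGET SHAPE = the displayed row VERBATIM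
`Function.Surjective (Node00.QOfRecord F N k U₀)`; trace INCLUDED»); the flat background `U₀ = 1` is dag-n07-w3 g24's ✓p815831 `N07QOfRecordFlatOnto.QOfRecord_one_surjective`, whose
plumbing (`cplxOp_surjective_of_skew`, `bondFieldIn∕Out_surjective`, ★ `QOfRecord_surjective_of_skew`) this file consumes BY NAME.  `--kind proof --supports stmt-QuantumFields-27238
--as helper` (K0ᴬ, the M1 ∕ text (B) line's key of record); count-neutral.  THEOREMS ONLY (0 `def`).

WHAT IS PROVED.
* §1 `sub_phase_mem_lieSU` (the traceless part `Z − (i Im tr Z∕N)·1` of a skew-Hermitian matrix is in `𝔰𝔲(N)`) · ★★★ `exists_skew_qSkewOp_eq` — torus `P`, `k ≤ m + K`, `U₀` with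
  `t₀`-plaquette-small iterated (0.4) averages below `k` (`stokesConst·t₀ < |I|⁻¹∕16` and `< δ_N`, the corrector's explicit thresholds): EVERY skew-Hermitian `Z : PBond P k → M_N(ℂ)` is
  `qSkewOp k U₀ Y` for a skew-Hermitian `Y` (`𝔲(N) = 𝔰𝔲(N) ⊕ iℝ` pointwise: part (A) for the `𝔰𝔲` part at the right-chart target `L^k·V₀⋆Z₀V₀`, part (B) for the phase part; `V₀V₀⋆ = 1`).
* §2 ★★★★ `QOfRecord_surjective_of_plaqSmall` — AT NODE 00's OBJECTS (`F : T4Family`, torus `F.P K`, averaging of record `avOfRecord F N K = blockAvg expMeanLogSU` (`rfl`), `k ≤ m + K`):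
  at every `U₀ : GaugeField (F.P K) 0 (SU N)` whose iterated averages `Ū^i(U₀)`, `i < k`, are `t₀`-plaquette-small with `stokesConst (F.P K)·t₀ < emlWeight (F.P K)∕16` and
  `< deltaSU (Fin N)`: **`Function.Surjective (Node00.QOfRecord F N k U₀)`** — def-Y's `hQ` VERBATIM (§1 through dag-n07-w3's `QOfRecord_surjective_of_skew`).
* §3 (v1.1, APPEND-ONLY) THE CLASS-MEMBER READINGS: ★★★ `QOfRecord_surjective_of_mem_bgReg` — every member `U₀` of the (2)-class `bgReg F N K k ε₀` (`|U₀(∂p) − 1| < ε₀η_k²`, [15] (2) at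
  scale `k`, no holes) for `ε₀` below four explicit ceilings (MODULE 35d `N07CritTangentInClass.plaqSmall_avgFamily_of_mem_bgReg`: [Balaban1985Averaging] Prop. 2 for (0.4),
  PROVED by n21-c, gives the per-level plaquette smallness `2ε₀`); ★★★ `QOfRecord_surjective_of_inUkClassB11` (the full space `𝔘_k({T}, ε₀)` of [15] (2),
  `InUkClassB11.mem_bgReg`); ★★★ `QOfRecord_surjective_of_isBackground` (every MINIMISER OF RECORD `IsBackground (avOfRecord F N K) (bgReg F N K k ε₀) k V U₀` — the
  background `U_k(V)` the pin is instantiated at); `exists_eps_QOfRecord_surjective_of_mem_bgReg` (NON-VACUITY of the ceilings: ONE `ε₀ > 0`, depending on `d`, `L`, `N` only,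
  serving every `K`, `k ≤ m + K`, `V`, `U₀` — 35d `exists_admissible_eps`).
* §4 (v1.2, APPEND-ONLY) AT THE SELECTOR OF RECORD: `ukSel_mem_bgReg` (`UkSel F N K k ε V ∈ bgReg F N K k ε` for EVERY `V` — a background on the solvable set, the flat field off it,
  `Node00/BackgroundSelOfRecord`); ★★★ `QOfRecord_surjective_ukSel` (`hQ` at `U₀ := UkSel F N K k ε V`, EVERY `V`, `ε` below the four ceilings, `k ≤ m + K`); ★★★
  `QOfRecord_surjective_gaugeAct` (the class is gauge-invariant — `gaugeAct_mem_bgReg'` — so `hQ` holds at every gauge transform of a member, with NO covariance statement for `Q_k`);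
  ★★★ `QOfRecord_surjective_rootGaugeC_ukSel` (`U₀ := rootGaugeC k (UkSel F N K k ε V)`, the CENTRED rooted gauge of `Thm/BalabanUVNodesRootedGaugeCentred` = the shape of DEF-1's
  `recordBgFieldC := rootGaugeC (k+1) (UkSel F 2 K (k+1) θ.εbg (unitField …))` — instantiation at `N := 2`, level `k+1`, `ε := θ.εbg` is the consumer's one line, PROVIDED `θ.εbg` is
  below the four ceilings: a NUMERIC side condition on the record's background radius, displayed, not discharged here).
* §5 (v1.3, APPEND-ONLY) ON THE GAUGE ORBIT OF THE FLAT FIELD, UNCONDITIONALLY: ★★★ `QOfRecord_surjective_gaugeAct_one` — `Function.Surjective (Node00.QOfRecord F N k (gaugeAct u 1))`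
  for EVERY gauge transformation `u` and `k ≤ m + K`, NO displayed ceiling (an admissible `ε₀` exists by 35d `exists_admissible_eps`, and `1 ∈ bgReg` at any positive radius) — the `hQ`
  slot of def-Y's pin at the pure-gauge backgrounds `U₀ = gaugeAct u 1` where dag-n07-w3's ✓p817063 `N07LaplaceAOfRecordGaugeOrbitPos.laplaceAOfRecord_pureGauge_pos` fills `hpos`.
WHAT THIS BUYS FOR P0 ∕ text (B): the pin `Node00.frakGOfRecordAtBg F N K k Ω U₀ a hpos hQ` can be instantiated at any background of the small-field class with `hQ :=
QOfRecord_surjective_of_plaqSmall …` — the consumer supplies the per-level plaquette smallness of `U₀` (for the minimiser ∕ `UkSel` of record: its small-field class membership at a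
radius below the corrector's threshold) and keeps `hpos` ([Balaban1985BackgroundPropagators] Thm 3.11 at the record) displayed.

HONEST FRAMING: count-neutral helper; composition BY NAME of parts (A), (B) and dag-n07-w3's flat∕plumbing file; the analytic input is the route `UnitScaleTilt`'s exact corrector (via
MODULE 35c) and elementary calculus — the thresholds are the corrector's (`|I|⁻¹∕16`, `δ_N = min(1∕3, π∕N)`), NOT print's `O(L²α₀)`; nothing of [Balaban1985Averaging] Sect. E ∕
[Balaban1985BackgroundPropagators] asserted; `hpos` untouched; P0 ∕ text (B) OPEN; K0ᴬ∕K1ᴬ∕K3ᴬ OPEN; N07 NOT discharged; COUNT 8∕27 (A 8∕28) · K 1∕4 UNMOVED; one finite 𝕋⁴ programme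
at fixed `ε` — NOT continuum ∕ ℝ⁴ ∕ OS ∕ mass gap ∕ Clay.  No `sorry`, no `def`, no `instance`, no `notation`; standard axioms.
-/

noncomputable section

open scoped Matrix.Norms.L2Operator Topology BigOperators
open Filter Asymptotics Function NormedSpace

namespace Summit.QuantumFields.YangMills.BalabanUVNodes.N07QOfRecordOntoSmallField

open Literature.MathematicalPhysics.QuantumFieldTheory.Balaban1983to89
open Literature.MathematicalPhysics.QuantumFieldTheory.Balaban1983to89.T4Continuum
open Literature.MathematicalPhysics.QuantumFieldTheory.Balaban1983to89.BlockAveraging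
open Literature.MathematicalPhysics.QuantumFieldTheory.Balaban1983to89.BlockAveragingEMLHaarAC (emlWeight)
open Literature.MathematicalPhysics.QuantumFieldTheory.Balaban1983to89.ExpMeanLog (expMeanLogSU deltaSU)
open Literature.MathematicalPhysics.QuantumFieldTheory.Balaban1983to89.T4AdjointCovarianceUnitary (lieSU mem_lieSU_iff conj_mem_lieSU)
open Literature.MathematicalPhysics.QuantumFieldTheory.Balaban1983to89.Node00
open Summit.QuantumFields.YangMills.Theorems.BlockAvgCorrector (stokesConst)
open Summit.QuantumFields.YangMills.BalabanUVNodes.N07AveragingSubmersionSmallField (exists_skew_dIterL_eq_mul_of_plaqSmall)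
open Summit.QuantumFields.YangMills.BalabanUVNodes.N07AveragingPhaseEquivariance (dIterL_phase_eq_flat_mul exists_phase_dIterL_one_eq)
open Summit.QuantumFields.YangMills.BalabanUVNodes.N07CritTangentConverse (smallBelow_of_plaqSmall)
open Summit.QuantumFields.YangMills.Theorems.N07QOfRecordFlatOnto (QOfRecord_surjective_of_skew)
open GaugeField (gaugeAct)

/-! ## §1  Every skew coarse field is `qSkewOp k U₀` of a skew fine field -/

section Skew

variable {P : Params} {N : ℕ} [NeZero N]

/-- **THE TRACELESS PART OF A SKEW-HERMITIAN MATRIX IS IN `𝔰𝔲(N)`**: `Z − (i·Im tr Z ∕ N)·1 ∈ lieSU` (the trace of a skew-Hermitian matrix is purely imaginary). [folklore] -/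
theorem sub_phase_mem_lieSU {Z : Matrix (Fin N) (Fin N) ℂ} (hZ : star Z = -Z) :
    Z - ((((((Matrix.trace Z).im / N : ℝ)) : ℂ) * Complex.I)) • (1 : Matrix (Fin N) (Fin N) ℂ) ∈ lieSU (Fin N) := by
  have hN : (N : ℂ) ≠ 0 := Nat.cast_ne_zero.2 (NeZero.ne N)
  have hre : (Matrix.trace Z).re = 0 := by
    have h1 : Matrix.trace (star Z) = star (Matrix.trace Z) := by
      rw [Matrix.star_eq_conjTranspose, Matrix.trace_conjTranspose]
    rw [hZ, Matrix.trace_neg] at h1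
    have h2 := congrArg Complex.re h1
    rw [Complex.neg_re, Complex.star_def, Complex.conj_re] at h2
    linarith
  rw [mem_lieSU_iff]
  refine ⟨?_, ?_⟩
  · rw [star_sub, hZ, star_smul, star_one, Complex.star_def, map_mul, Complex.conj_ofReal, Complex.conj_I, mul_neg, neg_smul]
    abel
  · rw [Matrix.trace_sub, Matrix.trace_smul, Matrix.trace_one, Fintype.card_fin, smul_eq_mul]
    have hN' : (N : ℝ) ≠ 0 := Nat.cast_ne_zero.2 (NeZero.ne N)
    apply Complex.ext
    · simp [hre]
    · simp only [Complex.sub_im, Complex.mul_im, Complex.mul_re, Complex.ofReal_re, Complex.ofReal_im, Complex.I_re, Complex.I_im,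
        Complex.natCast_re, Complex.natCast_im, mul_zero, sub_zero, mul_one, add_zero, zero_add, Complex.zero_im]
      field_simp
      ring


/-- ★★★ **EVERY SKEW-HERMITIAN COARSE FIELD IS `qSkewOp k U₀` OF A SKEW-HERMITIAN FINE FIELD, AT EVERY GUARDED SMALL-FIELD BACKGROUND** — torus `P`, level `k ≤ m + K`,
background `U₀` with `t₀`-plaquette-small iterated averages below `k` (`stokesConst·t₀ < |I|⁻¹∕16`, `< δ_N`): for every `Z : PBond P k → M_N(ℂ)` with `(Z c)⋆ = −Z c` there is
`Y : PBond P 0 → M_N(ℂ)` with `(Y b)⋆ = −Y b` and `qSkewOp k U₀ Y = Z` (def-Y's real form of print's `Q_k(U₀)`, `Node00/BgAveragingOfRecord` §2).  PROOF: split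
`Z = Z₀ + (iψ)·1` pointwise with `Z₀ ∈ 𝔰𝔲(N)` (`ψ = Im tr Z ∕ N`); the `𝔰𝔲` part is reached through part (A) `N07AveragingSubmersionSmallField.exists_skew_dIterL_eq_mul_of_plaqSmall`
at the right-chart target `L^k·V₀⋆Z₀V₀ ∈ 𝔰𝔲` (conjugation by the unitary `V₀ = Ū^k(U₀)`), the phase part through part (B) `N07AveragingPhaseEquivariance.dIterL_phase_eq_flat_mul` +
`exists_phase_dIterL_one_eq` (the U(1) line of `Q_k(U₀)` is the flat one, which is onto); `qSkewOp` is real-linear and `V₀V₀⋆ = 1` cancels the right trivialisation.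
[cite: Balaban1985Variational, (18) p.281, (44)–(45) p.285; Balaban1985BackgroundPropagators, (3.13)–(3.15) p.393; Balaban1987RG1, (0.4) p.253, (0.21) p.256] -/
theorem exists_skew_qSkewOp_eq {t₀ : ℝ} (ht₀ : 0 < t₀) (hst : stokesConst P * t₀ < emlWeight P / 16)
    (hstδ : stokesConst P * t₀ < deltaSU (Fin N)) {k : ℕ} (hk : k ≤ P.m + P.K) {U₀ : GaugeField P 0 (SU N)}
    (hsm : ∀ i, i < k → PlaqSmall t₀ (Averaging.iter (fun i => blockAvg (P := P) (j := i) (expMeanLogSU (n := Fin N))) i U₀))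
    (Z : PBond P k → Matrix (Fin N) (Fin N) ℂ) (hZ : ∀ c, star (Z c) = -Z c) :
    ∃ Y : PBond P 0 → Matrix (Fin N) (Fin N) ℂ, (∀ b, star (Y b) = -Y b) ∧ qSkewOp k U₀ Y = Z := by
  classical
  set av : ∀ j, Averaging P j (SU N) := fun i => blockAvg (P := P) (j := i) (expMeanLogSU (n := Fin N)) with hav
  set V₀ : GaugeField P k (SU N) := Averaging.iter av k U₀ with hV₀
  have hSB : SmallBelow av k U₀ := smallBelow_of_plaqSmall ht₀ hstδ hsm
  have hVM : iterM k (coeField U₀) = coeField V₀ := (coeField_iter_eq_iterM k hSB).symm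
  have hVu : ∀ c, ((V₀ c : SU N) : Matrix (Fin N) (Fin N) ℂ) * star ((V₀ c : SU N) : Matrix (Fin N) (Fin N) ℂ) = 1 := fun c =>
    Matrix.mem_unitaryGroup_iff.mp (Matrix.mem_specialUnitaryGroup_iff.mp (V₀ c).2).1
  have hVu' : ∀ c, star ((V₀ c : SU N) : Matrix (Fin N) (Fin N) ℂ) * ((V₀ c : SU N) : Matrix (Fin N) (Fin N) ℂ) = 1 := fun c =>
    Matrix.mem_unitaryGroup_iff'.mp (Matrix.mem_specialUnitaryGroup_iff.mp (V₀ c).2).1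
  -- split the target: traceless part `Z₀` and phase part `ψ`
  set ψ : PBond P k → ℝ := fun c => (Matrix.trace (Z c)).im / N with hψ
  set Z₀ : PBond P k → Matrix (Fin N) (Fin N) ℂ := fun c => Z c - ((((ψ c : ℝ) : ℂ) * Complex.I)) • (1 : Matrix (Fin N) (Fin N) ℂ) with hZ₀
  have hZ₀mem : ∀ c, Z₀ c ∈ lieSU (Fin N) := fun c => sub_phase_mem_lieSU (hZ c)
  -- the `𝔰𝔲` target in the right chart: `L^k · V₀⋆ Z₀ V₀`
  have hconj : ∀ c, star ((V₀ c : SU N) : Matrix (Fin N) (Fin N) ℂ) * Z₀ c * ((V₀ c : SU N) : Matrix (Fin N) (Fin N) ℂ) ∈ lieSU (Fin N) := by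
    intro c
    have hg : star ((V₀ c : SU N) : Matrix (Fin N) (Fin N) ℂ) ∈ Matrix.unitaryGroup (Fin N) ℂ :=
      Unitary.star_mem (Matrix.mem_specialUnitaryGroup_iff.mp (V₀ c).2).1
    have h := conj_mem_lieSU (hZ₀mem c) ⟨_, hg⟩
    simpa only [star_star] using h
  set Zsu : PBond P k → lieSU (Fin N) := fun c =>
    ⟨((P.L : ℝ) ^ k) • (star ((V₀ c : SU N) : Matrix (Fin N) (Fin N) ℂ) * Z₀ c * ((V₀ c : SU N) : Matrix (Fin N) (Fin N) ℂ)),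
      Submodule.smul_mem _ _ (hconj c)⟩ with hZsu
  -- (A): the `𝔰𝔲` directions
  obtain ⟨Y₁, hY₁, hD₁'⟩ := exists_skew_dIterL_eq_mul_of_plaqSmall ht₀ hst hstδ hk hsm Zsu
  have hD₁ : dIterL k (coeField U₀) (fun b => Y₁ b * (U₀ b : Matrix (Fin N) (Fin N) ℂ)) =
      fun c => ((V₀ c : SU N) : Matrix (Fin N) (Fin N) ℂ) * (Zsu c : Matrix (Fin N) (Fin N) ℂ) := hD₁'
  -- (B): the phase directions — the U(1) line of `Q_k(U₀)` is the flat one, and the flat one is onto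
  obtain ⟨θ, hθ⟩ := exists_phase_dIterL_one_eq (P := P) (N := N) k hk (fun c => (P.L : ℝ) ^ k * ψ c)
  have hD₂ : dIterL k (coeField U₀) (fun b => ((((θ b : ℝ) : ℂ) * Complex.I)) • (U₀ b : Matrix (Fin N) (Fin N) ℂ)) =
      fun c => (((((((P.L : ℝ) ^ k * ψ c : ℝ)) : ℂ) * Complex.I)) • (1 : Matrix (Fin N) (Fin N) ℂ)) * ((V₀ c : SU N) : Matrix (Fin N) (Fin N) ℂ) := by
    rw [dIterL_phase_eq_flat_mul hSB θ, hθ]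
  refine ⟨fun b => Y₁ b + ((((θ b : ℝ) : ℂ) * Complex.I)) • (1 : Matrix (Fin N) (Fin N) ℂ), fun b => ?_, ?_⟩
  · rw [star_add, hY₁ b, star_smul, star_one, Complex.star_def, map_mul, Complex.conj_ofReal, Complex.conj_I, mul_neg, neg_smul, neg_add]
  · funext c
    rw [qSkewOp_apply]
    have hsplit : (fun b => (Y₁ b + ((((θ b : ℝ) : ℂ) * Complex.I)) • (1 : Matrix (Fin N) (Fin N) ℂ)) * (U₀ b : Matrix (Fin N) (Fin N) ℂ)) =
        (fun b => Y₁ b * (U₀ b : Matrix (Fin N) (Fin N) ℂ)) + fun b => ((((θ b : ℝ) : ℂ) * Complex.I)) • (U₀ b : Matrix (Fin N) (Fin N) ℂ) := by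
      funext b
      simp only [Pi.add_apply, add_mul, smul_mul_assoc, one_mul]
    rw [hsplit, map_add, Pi.add_apply, hD₁, hD₂, hVM]
    simp only [coeField_apply, hZsu]
    -- algebra at the bond `c`
    have hL : ((P.L : ℂ) ^ k) ≠ 0 := pow_ne_zero _ (Nat.cast_ne_zero.2 P.L_pos.ne')
    have h1 : ((V₀ c : SU N) : Matrix (Fin N) (Fin N) ℂ) *
        (((P.L : ℝ) ^ k) • (star ((V₀ c : SU N) : Matrix (Fin N) (Fin N) ℂ) * Z₀ c * ((V₀ c : SU N) : Matrix (Fin N) (Fin N) ℂ))) *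
          star ((V₀ c : SU N) : Matrix (Fin N) (Fin N) ℂ) = ((P.L : ℝ) ^ k) • Z₀ c := by
      rw [mul_smul_comm, smul_mul_assoc]
      congr 1
      simp only [mul_assoc]
      rw [hVu c, mul_one, ← mul_assoc, hVu c, one_mul]
    have h2 : (((((P.L : ℝ) ^ k * ψ c : ℝ) : ℂ) * Complex.I) • (1 : Matrix (Fin N) (Fin N) ℂ)) * ((V₀ c : SU N) : Matrix (Fin N) (Fin N) ℂ) *
        star ((V₀ c : SU N) : Matrix (Fin N) (Fin N) ℂ) = ((((P.L : ℝ) ^ k * ψ c : ℝ) : ℂ) * Complex.I) • (1 : Matrix (Fin N) (Fin N) ℂ) := by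
      rw [smul_mul_assoc, one_mul, smul_mul_assoc, hVu c]
    have h3 : ((P.L : ℂ) ^ k)⁻¹ * ((((P.L : ℝ) ^ k * ψ c : ℝ) : ℂ) * Complex.I) = ((ψ c : ℝ) : ℂ) * Complex.I := by
      push_cast
      field_simp
    have h4 : ((P.L : ℂ) ^ k)⁻¹ * (((P.L : ℝ) ^ k : ℝ) : ℂ) = 1 := by
      push_cast
      exact inv_mul_cancel₀ hL
    rw [add_mul, h1, h2, ← Complex.coe_smul, smul_add, smul_smul, smul_smul, h3, h4, one_smul]
    simp only [hZ₀, hψ, sub_add_cancel]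

end Skew

/-! ## §2  def-Y's `hQ` at NODE 00's objects -/

section Record

variable {F : T4Family} {N : ℕ} [NeZero N]

/-- ★★★★ **`hQ` AT EVERY GUARDED SMALL-FIELD BACKGROUND OF RECORD** — on the torus `F.P K` with the averaging of record `avOfRecord F N K`, at a level `k ≤ m + K`, for every background
`U₀ : GaugeField (F.P K) 0 (SU N)` whose iterated averages `Ū^i(U₀)`, `i < k`, are `t₀`-plaquette-small with `stokesConst (F.P K)·t₀ < emlWeight (F.P K)∕16` and `< deltaSU (Fin N)`:
**`Function.Surjective (Node00.QOfRecord F N k U₀)`** — print's linearised `k`-fold averaging `Q_k(U₀)` of record, read between the lit carriers (def-Y ✓p814239), is ONTO; the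
displayed letter `hQ` of `Node00.frakGOfRecordAtBg` at such a `U₀` is this theorem (§1 through dag-n07-w3's `N07QOfRecordFlatOnto.QOfRecord_surjective_of_skew`).
[cite: Balaban1985BackgroundPropagators, (3.13)–(3.16) p.393, (3.21) p.394; Balaban1985Variational, (44)–(45) p.285; Balaban1987RG1, (0.4) p.253, (0.21) p.256] -/
theorem QOfRecord_surjective_of_plaqSmall {K k : ℕ} (hk : k ≤ (F.P K).m + (F.P K).K) {t₀ : ℝ} (ht₀ : 0 < t₀)
    (hst : stokesConst (F.P K) * t₀ < emlWeight (F.P K) / 16) (hstδ : stokesConst (F.P K) * t₀ < deltaSU (Fin N)) {U₀ : GaugeField (F.P K) 0 (SU N)}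
    (hsm : ∀ i, i < k → PlaqSmall t₀ (Averaging.iter (avOfRecord F N K) i U₀)) :
    Function.Surjective (QOfRecord F N k U₀) :=
  QOfRecord_surjective_of_skew F N K k U₀ fun Z hZ => by
    obtain ⟨Y, hY, h⟩ := exists_skew_qSkewOp_eq ht₀ hst hstδ hk hsm Z (fun c => by rw [Matrix.star_eq_conjTranspose]; exact hZ c)
    exact ⟨Y, fun b => by rw [← Matrix.star_eq_conjTranspose]; exact hY b, h⟩


/-! ## §3 (v1.1)  The class-member readings: every member of [15] (2)'s class, every minimiser of record -/

/-- ★★★ **`hQ` FOR EVERY MEMBER OF THE (2)-CLASS OF THE VARIATIONAL PROBLEM OF RECORD** — `U₀ ∈ bgReg F N K k ε₀` (`|U₀(∂p) − 1| < ε₀η_k²` on the finest torus; [15] (2) at scale `k`,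
no holes) with `ε₀` below the four explicit ceilings `143·((d+4)²∕4)²·ε₀ ≤ 1∕3`, `2ε₀ ≤ 2δ_N∕((d+4)L)²`, `stokesConst·2ε₀ < |I|⁻¹∕16`, `stokesConst·2ε₀ < δ_N`, and `k ≤ m + K`:
`Function.Surjective (Node00.QOfRecord F N k U₀)` (the per-level plaquette smallness `2ε₀` of `Ū^i(U₀)`, `i < k`, is MODULE 35d's reading of [Balaban1985Averaging] Prop. 2 for the
(0.4) average, PROVED in the tree). [cite: Balaban1985Variational, (2) p.278, (44)–(45) p.285; Balaban1985Averaging, Prop. 2 (52)–(54) p.26; Balaban1985BackgroundPropagators, (3.13)–(3.16) p.393] -/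
theorem QOfRecord_surjective_of_mem_bgReg {K k : ℕ} (hk : k ≤ (F.P K).m + (F.P K).K) {ε₀ : ℝ} (hε₀ : 0 < ε₀)
    (h3 : (143 * (((((F.P K).d + 4 : ℕ) : ℝ)) ^ 2 / 4) ^ 2) * ε₀ ≤ 1 / 3)
    (h2 : 2 * ε₀ ≤ 2 * deltaSU (Fin N) / ((((F.P K).d + 4) * (F.P K).L : ℕ) : ℝ) ^ 2)
    (hst : stokesConst (F.P K) * (2 * ε₀) < emlWeight (F.P K) / 16) (hstδ : stokesConst (F.P K) * (2 * ε₀) < deltaSU (Fin N))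
    {U₀ : GaugeField (F.P K) 0 (SU N)} (hU : U₀ ∈ bgReg F N K k ε₀) :
    Function.Surjective (QOfRecord F N k U₀) :=
  QOfRecord_surjective_of_plaqSmall hk (by positivity : (0 : ℝ) < 2 * ε₀) hst hstδ
    fun i hi => Summit.QuantumFields.YangMills.BalabanUVNodes.N07CritTangentInClass.plaqSmall_avgFamily_of_mem_bgReg hε₀ h3 h2 hU hi.le

/-- ★★★ **`hQ` ON [15] (2)'s FULL SPACE `𝔘_k({T}, ε₀)` AT THE RECORD** (`Node00.InUkClassB11`, both clauses of (2); its plaquette half is `bgReg`, `InUkClassB11.mem_bgReg`), `ε₀` below the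
four ceilings, `k ≤ m + K`. [cite: Balaban1985Variational, (2) p.278, (44)–(45) p.285; Balaban1985Averaging, Prop. 2 p.26; Balaban1985BackgroundPropagators, (3.13)–(3.16) p.393] -/
theorem QOfRecord_surjective_of_inUkClassB11 {K k : ℕ} (hk : k ≤ (F.P K).m + (F.P K).K) {ε₀ : ℝ} (hε₀ : 0 < ε₀)
    (h3 : (143 * (((((F.P K).d + 4 : ℕ) : ℝ)) ^ 2 / 4) ^ 2) * ε₀ ≤ 1 / 3)
    (h2 : 2 * ε₀ ≤ 2 * deltaSU (Fin N) / ((((F.P K).d + 4) * (F.P K).L : ℕ) : ℝ) ^ 2)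
    (hst : stokesConst (F.P K) * (2 * ε₀) < emlWeight (F.P K) / 16) (hstδ : stokesConst (F.P K) * (2 * ε₀) < deltaSU (Fin N))
    {U₀ : GaugeField (F.P K) 0 (SU N)} (hU : InUkClassB11 F N K k ε₀ U₀) :
    Function.Surjective (QOfRecord F N k U₀) :=
  QOfRecord_surjective_of_mem_bgReg hk hε₀ h3 h2 hst hstδ hU.mem_bgReg

/-- ★★★ **`hQ` AT EVERY MINIMISER OF RECORD OVER THE (2)-CLASS** — if `U₀` is a background of the variational problem of record over the class `bgReg F N K k ε₀` with datum `V`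
(`IsBackground (avOfRecord F N K) (bgReg F N K k ε₀) k V U₀`: `Ū^k(U₀) = V`, `U₀` in the class, `U₀` minimises (5) there — [15] Thm 1's object `U_k(V)`), `ε₀` below the four ceilings,
`k ≤ m + K`, then `Function.Surjective (Node00.QOfRecord F N k U₀)`: the pin `frakGOfRecordAtBg … U₀ a hpos hQ` has its `hQ` at the minimiser.
[cite: Balaban1985Variational, Thm 1 p.279, (2)–(8) pp.278–279, (44)–(45) p.285; Balaban1987RG1, (0.21) p.256, (1.1)–(1.2) p.260] -/
theorem QOfRecord_surjective_of_isBackground {K k : ℕ} (hk : k ≤ (F.P K).m + (F.P K).K) {ε₀ : ℝ} (hε₀ : 0 < ε₀)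
    (h3 : (143 * (((((F.P K).d + 4 : ℕ) : ℝ)) ^ 2 / 4) ^ 2) * ε₀ ≤ 1 / 3)
    (h2 : 2 * ε₀ ≤ 2 * deltaSU (Fin N) / ((((F.P K).d + 4) * (F.P K).L : ℕ) : ℝ) ^ 2)
    (hst : stokesConst (F.P K) * (2 * ε₀) < emlWeight (F.P K) / 16) (hstδ : stokesConst (F.P K) * (2 * ε₀) < deltaSU (Fin N))
    {V : GaugeField (F.P K) k (SU N)} {U₀ : GaugeField (F.P K) 0 (SU N)} (hbg : IsBackground (avOfRecord F N K) (bgReg F N K k ε₀) k V U₀) :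
    Function.Surjective (QOfRecord F N k U₀) :=
  QOfRecord_surjective_of_mem_bgReg hk hε₀ h3 h2 hst hstδ hbg.2.1

/-- **NON-VACUITY OF THE CEILINGS, UNIFORMLY**: there is ONE `ε₀ > 0` (depending on `d`, `L`, `N` through the torus parameters `F.P K` — the same numbers for every `K`, since `d`, `L`
are the family's) below all four ceilings, so that at EVERY member of `bgReg F N K k ε₀`, every `k ≤ m + K`, `Q_k(U₀)` of record is onto (35d `exists_admissible_eps`).
[cite: Balaban1985Variational, (2) p.278 (bookkeeping); Balaban1985Averaging, Prop. 2 p.26] -/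
theorem exists_eps_QOfRecord_surjective_of_mem_bgReg (K : ℕ) :
    ∃ ε₀ : ℝ, 0 < ε₀ ∧ ∀ k : ℕ, k ≤ (F.P K).m + (F.P K).K → ∀ U₀ : GaugeField (F.P K) 0 (SU N), U₀ ∈ bgReg F N K k ε₀ →
      Function.Surjective (QOfRecord F N k U₀) := by
  obtain ⟨ε₀, hε₀, h3, h2, hst, hstδ⟩ := Summit.QuantumFields.YangMills.BalabanUVNodes.N07CritTangentInClass.exists_admissible_eps (F.P K) N
  exact ⟨ε₀, hε₀, fun k hk U₀ hU => QOfRecord_surjective_of_mem_bgReg hk hε₀ h3 h2 hst hstδ hU⟩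


/-! ## §4 (v1.2)  At the selector of record `UkSel` and its centred rooted gauge -/

/-- **THE SELECTOR OF RECORD IS IN THE (2)-CLASS FOR EVERY DATUM**: `UkSel F N K k ε V ∈ bgReg F N K k ε` — on the solvable set it is a background over that class
(`isBackground_UkSel`), off it the flat field (`UkSel_of_not`, `one_mem_bgReg`). [cite: Balaban1987RG1, (0.21) p.256; Balaban1985Variational, (2) p.278, Thm 1 p.279] -/
theorem ukSel_mem_bgReg {K k : ℕ} (hk : k ≤ (F.P K).m + (F.P K).K) {ε : ℝ} (hε : 0 < ε) (V : GaugeField (F.P K) k (SU N)) :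
    UkSel F N K k ε V ∈ bgReg F N K k ε := by
  by_cases h : UkExists F N K k ε V
  · exact (isBackground_UkSel hk h).2.1
  · rw [UkSel_of_not h]
    exact one_mem_bgReg K k hε

/-- ★★★ **`hQ` AT THE SELECTOR OF RECORD, EVERY DATUM**: for `ε` below the four ceilings and `k ≤ m + K`, `Function.Surjective (Node00.QOfRecord F N k (UkSel F N K k ε V))` for EVERY
`V : GaugeField (F.P K) k (SU N)` (§3 at the class member `UkSel … V`). [cite: Balaban1985Variational, Thm 1 p.279, (44)–(45) p.285; Balaban1985BackgroundPropagators, (3.13)–(3.16) p.393; Balaban1987RG1, (0.21) p.256] -/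
theorem QOfRecord_surjective_ukSel {K k : ℕ} (hk : k ≤ (F.P K).m + (F.P K).K) {ε₀ : ℝ} (hε₀ : 0 < ε₀)
    (h3 : (143 * (((((F.P K).d + 4 : ℕ) : ℝ)) ^ 2 / 4) ^ 2) * ε₀ ≤ 1 / 3)
    (h2 : 2 * ε₀ ≤ 2 * deltaSU (Fin N) / ((((F.P K).d + 4) * (F.P K).L : ℕ) : ℝ) ^ 2)
    (hst : stokesConst (F.P K) * (2 * ε₀) < emlWeight (F.P K) / 16) (hstδ : stokesConst (F.P K) * (2 * ε₀) < deltaSU (Fin N))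
    (V : GaugeField (F.P K) k (SU N)) :
    Function.Surjective (QOfRecord F N k (UkSel F N K k ε₀ V)) :=
  QOfRecord_surjective_of_mem_bgReg hk hε₀ h3 h2 hst hstδ (ukSel_mem_bgReg hk hε₀ V)

/-- ★★★ **`hQ` AT EVERY GAUGE TRANSFORM OF A CLASS MEMBER** — the (2)-class is gauge-invariant (`gaugeAct_mem_bgReg'`), so for `U₀ ∈ bgReg F N K k ε₀` and ANY gauge transformation
`u`, `Function.Surjective (Node00.QOfRecord F N k (gaugeAct u U₀))` (no covariance statement for `Q_k` is needed: the hypothesis of §3 is gauge-invariant).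
[cite: Balaban1985Variational, (2),(4) p.278, (44)–(45) p.285; Balaban1985BackgroundPropagators, (3.13)–(3.16) p.393] -/
theorem QOfRecord_surjective_gaugeAct {K k : ℕ} (hk : k ≤ (F.P K).m + (F.P K).K) {ε₀ : ℝ} (hε₀ : 0 < ε₀)
    (h3 : (143 * (((((F.P K).d + 4 : ℕ) : ℝ)) ^ 2 / 4) ^ 2) * ε₀ ≤ 1 / 3)
    (h2 : 2 * ε₀ ≤ 2 * deltaSU (Fin N) / ((((F.P K).d + 4) * (F.P K).L : ℕ) : ℝ) ^ 2)
    (hst : stokesConst (F.P K) * (2 * ε₀) < emlWeight (F.P K) / 16) (hstδ : stokesConst (F.P K) * (2 * ε₀) < deltaSU (Fin N))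
    {U₀ : GaugeField (F.P K) 0 (SU N)} (hU : U₀ ∈ bgReg F N K k ε₀) (u : GaugeTransf (F.P K) 0 (SU N)) :
    Function.Surjective (QOfRecord F N k (gaugeAct u U₀)) :=
  QOfRecord_surjective_of_mem_bgReg hk hε₀ h3 h2 hst hstδ (gaugeAct_mem_bgReg' u U₀ hU)

/-- ★★★ **`hQ` AT THE CENTRED ROOTED GAUGE OF THE SELECTOR OF RECORD** — `U₀ := rootGaugeC k (UkSel F N K k ε₀ V)` (`rootGaugeC k U = gaugeAct (combTransporter k U) U`,
`Thm/BalabanUVNodesRootedGaugeCentred`): the SHAPE of DEF-1's `recordBgFieldC := rootGaugeC (k+1) (UkSel F 2 K (k+1) θ.εbg (unitField …))`; for `ε₀` below the four ceilings and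
`k ≤ m + K`, `Function.Surjective (Node00.QOfRecord F N k U₀)` for EVERY `V` (the consumer's instantiation at `N := 2`, level `k+1`, `ε₀ := θ.εbg` carries the numeric side condition
«`θ.εbg` below the ceilings» — displayed there, not discharged here). [cite: Balaban1985Variational, (19) p.281, (44)–(45) p.285, Thm 1 p.279; Balaban1985BackgroundPropagators, (3.13)–(3.16) p.393; Balaban1987RG1, (0.21) p.256] -/
theorem QOfRecord_surjective_rootGaugeC_ukSel {K k : ℕ} (hk : k ≤ (F.P K).m + (F.P K).K) {ε₀ : ℝ} (hε₀ : 0 < ε₀)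
    (h3 : (143 * (((((F.P K).d + 4 : ℕ) : ℝ)) ^ 2 / 4) ^ 2) * ε₀ ≤ 1 / 3)
    (h2 : 2 * ε₀ ≤ 2 * deltaSU (Fin N) / ((((F.P K).d + 4) * (F.P K).L : ℕ) : ℝ) ^ 2)
    (hst : stokesConst (F.P K) * (2 * ε₀) < emlWeight (F.P K) / 16) (hstδ : stokesConst (F.P K) * (2 * ε₀) < deltaSU (Fin N))
    (V : GaugeField (F.P K) k (SU N)) :
    Function.Surjective (QOfRecord F N k (Summit.QuantumFields.YangMills.Theorems.RootedGaugeCentred.rootGaugeC k (UkSel F N K k ε₀ V))) :=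
  QOfRecord_surjective_gaugeAct hk hε₀ h3 h2 hst hstδ (ukSel_mem_bgReg hk hε₀ V) _


/-! ## §5 (v1.3)  On the gauge orbit of the flat field, unconditionally -/

/-- ★★★ **`hQ` AT EVERY PURE-GAUGE BACKGROUND, NO DISPLAYED CEILING**: for every gauge transformation `u` and `k ≤ m + K`, `Function.Surjective (Node00.QOfRecord F N k (gaugeAct u 1))`
— an admissible `ε₀ > 0` below the four ceilings exists (35d `exists_admissible_eps`), the flat field is in `bgReg` at that radius (`one_mem_bgReg`), and the class is gauge-invariant (§4
`QOfRecord_surjective_gaugeAct`).  The companion of dag-n07-w3's `N07LaplaceAOfRecordGaugeOrbitPos.laplaceAOfRecord_pureGauge_pos` (`hpos` on the same orbit): at `U₀ = gaugeAct u 1`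
both displayed proofs of def-Y's pin are theorems of the tree. [cite: Balaban1985Variational, (4) p.278, (44)–(45) p.285; Balaban1985BackgroundPropagators, (3.13)–(3.16) p.393, (3.32)–(3.34) p.396] -/
theorem QOfRecord_surjective_gaugeAct_one {K k : ℕ} (hk : k ≤ (F.P K).m + (F.P K).K) (u : GaugeTransf (F.P K) 0 (SU N)) :
    Function.Surjective (QOfRecord F N k (gaugeAct u (1 : GaugeField (F.P K) 0 (SU N)))) := by
  obtain ⟨ε₀, hε₀, h3, h2, hst, hstδ⟩ := Summit.QuantumFields.YangMills.BalabanUVNodes.N07CritTangentInClass.exists_admissible_eps (F.P K) N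
  exact QOfRecord_surjective_gaugeAct hk hε₀ h3 h2 hst hstδ (one_mem_bgReg K k hε₀) u

/-- ★ **… AND AT THE FLAT FIELD ITSELF BY THE SMALL-FIELD ROAD** (`k ≤ m + K`; the same statement as dag-n07-w3's flat-road `N07QOfRecordFlatOnto.QOfRecord_one_surjective`, reached here
through the corrector ∕ phase-equivariance road — a consistency exhibit, not a second proof of record). [cite: Balaban1985Variational, (44)–(45) p.285; Balaban1985BackgroundPropagators, (3.13)–(3.16) p.393] -/
theorem QOfRecord_surjective_one_of_smallField {K k : ℕ} (hk : k ≤ (F.P K).m + (F.P K).K) :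
    Function.Surjective (QOfRecord F N k (1 : GaugeField (F.P K) 0 (SU N))) := by
  obtain ⟨ε₀, hε₀, h3, h2, hst, hstδ⟩ := Summit.QuantumFields.YangMills.BalabanUVNodes.N07CritTangentInClass.exists_admissible_eps (F.P K) N
  exact QOfRecord_surjective_of_mem_bgReg hk hε₀ h3 h2 hst hstδ (one_mem_bgReg K k hε₀)

end Record

end Summit.QuantumFields.YangMills.BalabanUVNodes.N07QOfRecordOntoSmallField

end
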